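/-
Copyright (c) 2026 the pub-hodgecm-mathlib formalisation cell (harness21).  Prover seat hodgecm-mathlib-K2E1-p11 (g5), Track B ∕ K2-LIT, h413 = `stmt-HodgeConjecture-24833`,
R90-TF section S8 «ContSpec-n½», socket B MID ∕ (V) OF RECORD, RULING J-S8-ℓCT (S8 dealer R90-CS-plan (g3), S8-R223 (ii) ∕ S8-R224 (1)): THE ℓ-CT LEDGER OF RECORD — the row-(ii) letters
`ψ φt hE3 hfac hφt hg₀ hφtbd` of ★ (V) OF RECORD (ED. 7 ∕ 8, :114–:119) DISCHARGED modulo the per-translate AMPLITUDE ROWS `Ag hAg hAg1 hM hψ2` (+ the visible scalar data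
`q qc hqcq hPcd hqa A hA hA32 cS hq`): `ψ` and `hE3` by DEFINITION, `φt hφt hg₀ hφtbd` by ★ (a-7), `hfac` by ★ (a-8)'s identity theorem re-run on a CO-DISCRETE complement.
-/
import Summits.HodgeConjecture.HodgeConjecture.Theorems.K2E1ChiConstantTermHolomorphicCMThree   -- ★ (K2E1-p15): `differentiableOn_borelConstantTerm_family`, `differentiableOn_middleCoefficient_of_borelConstantTerm`; brings `borelConstantTerm`, `borelHeight_pos`, the CM frame
import Summits.HodgeConjecture.HodgeConjecture.Theorems.K2E1ChiIntertwinedSectionProfileU3      -- ★ (a-7) (R90-CS-p03): `normalisedSection_letters`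
import Summits.HodgeConjecture.HodgeConjecture.Theorems.K2E1ConvexDiffCountableConnected        -- ★ `isPreconnected_convex_diff_of_countable`, `countable_of_codiscrete`; brings ★ `one_lt_rank_real_complex`
import Mathlib.Analysis.Complex.Convex
import Mathlib.Analysis.Complex.CauchyIntegral
import Mathlib.Analysis.Analytic.Uniqueness
import HarnessLib

/-!
# h413 ∕ R90-S8 — `K2E1ChiConstantTermLedgerOfRecordCMThree`: THE ℓ-CT LEDGER OF RECORD — (V)'s row-(ii) letters `ψ φt hE3 hfac hφt hg₀ hφtbd` FROM THE AMPLITUDE ROWS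

Cell `pub/hodgecm-mathlib`, crux H413 = `stmt-HodgeConjecture-24833`, route `HCCMUnconditional`; R90-TF section S8 «ContSpec-n½», socket B MID :358 ∕ (V) OF RECORD (★ ED. 7 p864491 ∕
ED. 8 p864565; keeper C133-p02 (g2) for ED. 9).  THEOREMS ONLY (no `def`, no `instance`, no `notation`, no named-fact hypothesis, no `sorry`; default heartbeats); lane
`--supports stmt-HodgeConjecture-24833 --as helper` (count-neutral).  CLOSES NO SOCKET.

RULING J-S8-ℓCT (S8-R223 (ii), this seat's census R90 bus 2026-09-05T02:21:36Z (ii)).  (V) OF RECORD shows, in its row (ii), seven ℓ-CT letters about a continued family `E` and its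
section `φ`: functions `ψ φt : ℂ → G(𝔸) → ℂ`, the SHAPE `hE3 : (E z)_B g = φ g·H(g)^z + ψ z g·H(g)^{2−z}` on the row's domain, the FACTORISATION `hfac : ψ z g = qc z·φt z g` near `3∕2`
(punctured), and the PROFILE `hφt` (continuity of `φt · g` at `3∕2`), `hg₀` (`φt (3∕2) g₀ ≠ 0`), `hφtbd` (`‖φt (3∕2) g‖ ≤ Cφt`).  They COLLAPSE to the per-translate AMPLITUDE ROWS of the
unfolding road (J-S8-U): `Ag : G(𝔸) → ℂ → ℂ` with `hAg` (each `Ag g` holomorphic on `{1 < Re}`), `hAg1 : Ag g₁ = A` (the named amplitude of record at the base point), `hM`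
(`‖Ag g (3∕2)‖ ≤ M` uniformly in `g`) and the UNFOLDING ROW `hψ2 : ((E z)_B g − φ g·H^z)∕H^{2−z} = Ag g z·cS z` on `{2 < Re}`, next to the already-visible scalar data `q qc hqcq hPcd hqa`
(★ `midWitnessExports_spec`) and `A hA hA32 cS hq` (★ p864534, ★ `hA32_shifted_of_record_at_basePoint`, ★ p864589's `hsrc`):
* `ψ z g := ((E z)_B g − φ g·H(g)^z) ∕ H(g)^{2−z}` — `H(g) > 0` (★ `borelHeight_pos`), so `hE3` holds at EVERY `z` by `div_mul_cancel` (K2E1-p12's device of ★ `ctPackage_of_scalarRoad`);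
* `φt z g := Ag g z ∕ A z` — `hφt hg₀ hφtbd` are ★ (a-7) `normalisedSection_letters` (`g₀ := g₁`, `Cφt := M ∕ ‖A (3∕2)‖`);
* `hfac` is ★ (a-8)'s identity theorem for `ψ·A − qc·Ag` on the preconnected `{1<Re} ∖ (C ∪ P)`, here RE-RUN with the finite `Sp` of (a-8) replaced by any CLOSED COUNTABLE `C` avoided by
  a punctured neighbourhood of `3∕2` (§1) — because the (V) road's rows live on `D = ({1<Re} ∖ {3∕2}) ∩ Pᶜ`, i.e. `C := {3∕2} ∪ P` with `P` the named co-discrete candidate pole set,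
  not on a finite-slit plane; the holomorphy of `ψ · g` on `{1<Re} ∖ C` comes from the rows `hEd hE4 hEbd` of `E` there (★ `differentiableOn_borelConstantTerm_family` ∘ ★
  `differentiableOn_middleCoefficient_of_borelConstantTerm`).
* §1 (generic `G`) **`eventually_factorisation_of_unfolded_off`** — ★ (a-8) with `Sp : Finset` generalised to a closed countable `C` punctured-avoided at `3∕2`.
* §2 (CM pair, `N = 3`) HEAD **`ctLedger_of_amplitudeRows`** — rows of `E` on the open `{1<Re} ∖ C` + scalar data + amplitude rows ⊢ `∃ ψ φt, hE3 (all z, g) ∧ hfac ∧ hφt ∧ hg₀ ∧ hφtbd`;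
  **`ctLedger_of_amplitudeRows_codiscrete`** — the same at (V) OF RECORD's domain `({1<Re} ∖ {3∕2}) ∩ Pᶜ` (`P` closed, co-discrete).
USE ((V) ED. 9+, keeper C133-p02): `obtain ⟨ψ, φt, hE3, hfac, hφt, hg₀, hφtbd⟩ := ctLedger_of_amplitudeRows_codiscrete L ν h𝓕N h𝓕c E φ hPc hPcd hEd hE4 hEbd q qc hqcq hPcd′ hqa A hA hA32 cS hq
Ag hAg g₁ hAg1 hM hψ2` with `E :=` the (twisted) named family and `φ :=` the (twisted) witness section; visible afterwards: the amplitude rows (K2E1-p13's naming file ∕ CS-p03's head at a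
general translate) and the scalar data already on the ledger.
HONEST LABEL: HC_CM is proved only modulo the 7 printed citations (2 remaining named inputs: hLiu418 = `stmt-HodgeConjecture-24832`, h413 = `stmt-HodgeConjecture-24833`) until rung 0
closes; REL ≠ ★ ≠ BUILT; this file asserts no named fact, is conditional by construction on the amplitude rows, and closes no socket; count-neutral.

## References
* [MoeglinWaldspurger1995] C. Mœglin, J.-L. Waldspurger, *Spectral Decomposition and Eisenstein Series* (1995), II.1.7, IV.1.9–IV.1.11.
* [Langlands1976] R. P. Langlands, *On the Functional Equations Satisfied by Eisenstein Series*, LNM 544 (1976), §6–§7, Appendix.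
* [Conway1978] J. B. Conway, *Functions of One Complex Variable I*, 2nd ed. (1978), IV §3 (identity theorem).
* [Rogawski1990] J. D. Rogawski, *Automorphic Representations of Unitary Groups in Three Variables* (1990), §2.1, §13.9 p. 229 (ii).
-/

set_option autoImplicit false
set_option linter.dupNamespace false  -- the mandated namespace repeats the summit's segment (`HodgeConjecture.HodgeConjecture`)

noncomputable section

open MeasureTheory Measure Filter Set Topology NumberField IsDedekindDomain
open scoped NNReal ENNReal
open Literature.Topology.Euclidean (one_lt_rank_real_complex)
open Literature.NumberTheory.Automorphic Literature.NumberTheory.Automorphic.UnitaryGroup AdelicGroupData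
open Summit.HodgeConjecture.HodgeConjecture.Cruxes.H413.K2E1ConvexDiffCountableConnected (isPreconnected_convex_diff_of_countable countable_of_codiscrete)
open Summit.HodgeConjecture.HodgeConjecture.Cruxes.H413.K2E1ChiConstantTermHolomorphicCMThree (differentiableOn_borelConstantTerm_family differentiableOn_middleCoefficient_of_borelConstantTerm)
open Summit.HodgeConjecture.HodgeConjecture.Cruxes.H413.K2E1ChiIntertwinedSectionProfileU3 (normalisedSection_letters)

namespace Summit.HodgeConjecture.HodgeConjecture.Cruxes.H413.K2E1ChiConstantTermLedgerOfRecordCMThree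

/-! ## §1 Generic: ★ (a-8)'s factorisation near `3∕2`, the finite slit generalised to a closed countable set -/

/-- **★ (a-8) ON A CO-COUNTABLE DOMAIN**: ★ `eventually_factorisation_of_unfolded` VERBATIM with its finite `Sp` replaced by a closed countable `C ⊆ ℂ` avoided by a punctured neighbourhood
of `3∕2` — scalar letters `(q qc) {P} hqcq hPcd hqa`, `A₁` holomorphic on `{1<Re}` with `A₁ (3∕2) ≠ 0`, `q = A₁·cS` on `{2<Re}`, amplitudes `Ag g` holomorphic on `{1<Re}` with the
unfolding `ψ z g = Ag g z·cS z` on `{2<Re}`, and `ψ · g` holomorphic on `{1<Re} ∖ C` ⊢ `∀ᶠ z in 𝓝[≠] (3∕2), ∀ g, ψ z g = qc z·(Ag g z ∕ A₁ z)` (identity theorem for `ψ·A₁ − qc·Ag` on the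
preconnected `{1<Re} ∖ (C ∪ P)`, ★ `isPreconnected_convex_diff_of_countable`). [cite: MoeglinWaldspurger1995, IV.1.11] [cite: Langlands1976, Appendix] [cite: Conway1978, IV §3] -/
theorem eventually_factorisation_of_unfolded_off {G : Type*} (ψ : ℂ → G → ℂ) (q qc : ℂ → ℂ) {P : Set ℂ}
    (hqcq : ∀ z : ℂ, 2 < z.re → qc z = q z) (hPcd : ∀ z₀ : ℂ, ∀ᶠ s in 𝓝[≠] z₀, s ∉ P) (hqa : ∀ z : ℂ, z ∉ P → AnalyticAt ℂ qc z)
    (A₁ : ℂ → ℂ) (hA : DifferentiableOn ℂ A₁ {z : ℂ | 1 < z.re}) (hA32 : A₁ (3 / 2) ≠ 0)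
    (cS : ℂ → ℂ) (hq : ∀ z : ℂ, 2 < z.re → q z = A₁ z * cS z)
    (Ag : G → ℂ → ℂ) (hAg : ∀ g, DifferentiableOn ℂ (Ag g) {z : ℂ | 1 < z.re}) (hψ2 : ∀ z : ℂ, 2 < z.re → ∀ g, ψ z g = Ag g z * cS z)
    {C : Set ℂ} (hCc : IsClosed C) (hCcount : C.Countable) (hC32 : ∀ᶠ z in 𝓝[≠] ((3 : ℂ) / 2), z ∉ C)
    (hψa : ∀ g, DifferentiableOn ℂ (fun z => ψ z g) ({z : ℂ | 1 < z.re} \ C)) :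
    ∀ᶠ z in 𝓝[≠] ((3 : ℂ) / 2), ∀ g, ψ z g = qc z * (Ag g z / A₁ z) := by
  set V : Set ℂ := {z : ℂ | 1 < z.re} \ (C ∪ P) with hV
  have hCPc : (C ∪ P).Countable := hCcount.union (countable_of_codiscrete hPcd)
  have hopen : IsOpen {z : ℂ | 1 < z.re} := isOpen_lt continuous_const Complex.continuous_re
  have hVpc : IsPreconnected V := isPreconnected_convex_diff_of_countable one_lt_rank_real_complex (convex_halfSpace_re_gt 1) hopen hCPc
  have hopen2 : IsOpen {z : ℂ | 2 < z.re} := isOpen_lt continuous_const Complex.continuous_re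
  have hopenS : IsOpen ({z : ℂ | 1 < z.re} \ C) := hopen.sdiff hCc
  -- a base point `z₁` with `2 < Re z₁` outside `C ∪ P`
  obtain ⟨z₁, hz₁C, hz₁⟩ : ∃ z₁, z₁ ∈ (C ∪ P)ᶜ ∧ z₁ ∈ {z : ℂ | 2 < z.re} :=
    (hCPc.dense_compl ℝ).exists_mem_open hopen2 ⟨3, by show (2 : ℝ) < (3 : ℂ).re; norm_num⟩
  have hz₁' : 2 < z₁.re := hz₁
  -- `F_g := ψ·A₁ − qc·Ag` vanishes on `V`
  have hF : ∀ g, EqOn (fun z => ψ z g * A₁ z - qc z * Ag g z) 0 V := fun g => by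
    have han : AnalyticOnNhd ℂ (fun z => ψ z g * A₁ z - qc z * Ag g z) V := by
      intro z hz
      have hz1 : z ∈ {z : ℂ | 1 < z.re} := hz.1
      have hzS : z ∈ {z : ℂ | 1 < z.re} \ C := ⟨hz.1, fun h => hz.2 (Or.inl h)⟩
      have hzP : z ∉ P := fun h => hz.2 (Or.inr h)
      exact (((hψa g).analyticAt (hopenS.mem_nhds hzS)).mul (hA.analyticAt (hopen.mem_nhds hz1))).sub
        ((hqa z hzP).mul ((hAg g).analyticAt (hopen.mem_nhds hz1)))
    have hz₁V : z₁ ∈ V := ⟨show (1 : ℝ) < z₁.re by linarith, hz₁C⟩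
    have hev : (fun z => ψ z g * A₁ z - qc z * Ag g z) =ᶠ[𝓝 z₁] 0 := by
      filter_upwards [hopen2.mem_nhds hz₁] with z hz
      have hz' : 2 < z.re := hz
      simp only [Pi.zero_apply]
      rw [hψ2 z hz' g, hqcq z hz', hq z hz']
      ring
    exact han.eqOn_zero_of_preconnected_of_eventuallyEq_zero hVpc hz₁V hev
  -- near `3∕2` (punctured): `z ∈ V` and `A₁ z ≠ 0`
  have h32mem : ((3 : ℂ) / 2) ∈ {z : ℂ | 1 < z.re} := by
    show (1 : ℝ) < ((3 : ℂ) / 2).re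
    norm_num
  have hA1 : ∀ᶠ z in 𝓝 ((3 : ℂ) / 2), A₁ z ≠ 0 := (hA.continuousOn.continuousAt (hopen.mem_nhds h32mem)).eventually_ne hA32
  filter_upwards [mem_nhdsWithin_of_mem_nhds (hopen.mem_nhds h32mem), hC32, hPcd ((3 : ℂ) / 2), mem_nhdsWithin_of_mem_nhds hA1] with z hz1 hzS hzP hzA g
  have hzV : z ∈ V := ⟨hz1, fun h => h.elim hzS hzP⟩
  have h0 := hF g hzV
  simp only [Pi.zero_apply, sub_eq_zero] at h0
  rw [mul_div_assoc', eq_div_iff hzA]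
  exact h0

/-! ## §2 The CM pair `L ∕ L⁺`, `N = 3`: the ℓ-CT ledger of record from the amplitude rows -/

section CM

variable (L : Type) [Field L] [NumberField L] [IsCMField L]
variable [MeasurableSpace (quasiSplit (↥(maximalRealSubfield L)) L (IsCMField.complexConj L) 3).Adelic] [BorelSpace (quasiSplit (↥(maximalRealSubfield L)) L (IsCMField.complexConj L) 3).Adelic]

/-- **THE ℓ-CT LEDGER OF RECORD FROM THE AMPLITUDE ROWS** (HEAD; module docstring).  Frame: a Haar measure `ν` of the Heisenberg radical and a fundamental domain `𝓕` of compact closure; a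
family `E : ℂ → G(𝔸) → ℂ` carrying the rows `hEd hE4 hEbd` on the open `{1<Re} ∖ C`, `C` closed countable and avoided by a punctured neighbourhood of `3∕2`; a function `φ` (the section);
the scalar data `q qc hqcq hPcd hqa`, `A hA hA32`, `cS hq`; the amplitude rows `Ag hAg`, `hAg1 : Ag g₁ = A`, `hM`, and the unfolding row `hψ2` on `{2<Re}`.  THEN `∃ ψ φt`, the SHAPE
`(E z)_B g = φ g·H(g)^z + ψ z g·H(g)^{2−z}` for ALL `z, g`, the FACTORISATION `ψ z g = qc z·φt z g` on a punctured neighbourhood of `3∕2`, continuity of `φt · g` at `3∕2`, `φt (3∕2) g₁ ≠ 0`,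
and `‖φt (3∕2) g‖ ≤ M ∕ ‖A (3∕2)‖` — i.e. (V) OF RECORD's `ψ φt hE3 hfac hφt hg₀ hφtbd` (`g₀ := g₁`, `Cφt := M ∕ ‖A (3∕2)‖`).
[cite: MoeglinWaldspurger1995, II.1.7, IV.1.9–IV.1.11] [cite: Langlands1976, §7, Appendix] [cite: Rogawski1990, §2.1] -/
theorem ctLedger_of_amplitudeRows
    (ν : Measure ↥(adelicUnipotent (↥(maximalRealSubfield L)) L (IsCMField.complexConj L) 3)) [ν.IsHaarMeasure] {𝓕 : Set ↥(adelicUnipotent (↥(maximalRealSubfield L)) L (IsCMField.complexConj L) 3)}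
    (h𝓕N : IsFundamentalDomain ↥(rationalUnipotent (↥(maximalRealSubfield L)) L (IsCMField.complexConj L) 3) 𝓕 ν) (h𝓕c : IsCompact (closure 𝓕))
    (E : ℂ → (quasiSplit (↥(maximalRealSubfield L)) L (IsCMField.complexConj L) 3).Adelic → ℂ) (φ : (quasiSplit (↥(maximalRealSubfield L)) L (IsCMField.complexConj L) 3).Adelic → ℂ)
    -- the rows of `E` on the open `{1<Re} ∖ C`
    {C : Set ℂ} (hCc : IsClosed C) (hCcount : C.Countable) (hC32 : ∀ᶠ z in 𝓝[≠] ((3 : ℂ) / 2), z ∉ C)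
    (hEd : ∀ g, DifferentiableOn ℂ (fun z => E z g) ({z : ℂ | 1 < z.re} \ C)) (hE4 : ∀ z ∈ ({z : ℂ | 1 < z.re} \ C), Continuous (E z))
    (hEbd : ∀ z₁ ∈ ({z : ℂ | 1 < z.re} \ C), ∀ K : Set (quasiSplit (↥(maximalRealSubfield L)) L (IsCMField.complexConj L) 3).Adelic, IsCompact K → ∃ V ∈ 𝓝 z₁, ∃ M : ℝ, ∀ z ∈ V, ∀ g ∈ K, ‖E z g‖ ≤ M)
    -- the scalar data of record
    (q qc : ℂ → ℂ) {P : Set ℂ} (hqcq : ∀ z : ℂ, 2 < z.re → qc z = q z) (hPcd : ∀ z₀ : ℂ, ∀ᶠ s in 𝓝[≠] z₀, s ∉ P) (hqa : ∀ z : ℂ, z ∉ P → AnalyticAt ℂ qc z)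
    (A : ℂ → ℂ) (hA : DifferentiableOn ℂ A {z : ℂ | 1 < z.re}) (hA32 : A (3 / 2) ≠ 0)
    (cS : ℂ → ℂ) (hq : ∀ z : ℂ, 2 < z.re → q z = A z * cS z)
    -- THE AMPLITUDE ROWS (J-S8-U): per-translate amplitudes, the base point, the uniform bound at `3∕2`, the unfolding on the tube
    (Ag : (quasiSplit (↥(maximalRealSubfield L)) L (IsCMField.complexConj L) 3).Adelic → ℂ → ℂ) (hAg : ∀ g, DifferentiableOn ℂ (Ag g) {z : ℂ | 1 < z.re}) (g₁ : (quasiSplit (↥(maximalRealSubfield L)) L (IsCMField.complexConj L) 3).Adelic) (hAg1 : Ag g₁ = A)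
    {M : ℝ} (hM : ∀ g, ‖Ag g (3 / 2)‖ ≤ M)
    (hψ2 : ∀ z : ℂ, 2 < z.re → ∀ g : (quasiSplit (↥(maximalRealSubfield L)) L (IsCMField.complexConj L) 3).Adelic, (borelConstantTerm ν 𝓕 (E z) g - φ g * (((borelHeight g : ℝ≥0) : ℝ) : ℂ) ^ z) / (((borelHeight g : ℝ≥0) : ℝ) : ℂ) ^ (2 - z) = Ag g z * cS z) :
    ∃ (ψ φt : ℂ → (quasiSplit (↥(maximalRealSubfield L)) L (IsCMField.complexConj L) 3).Adelic → ℂ),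
      (∀ (z : ℂ) (g : (quasiSplit (↥(maximalRealSubfield L)) L (IsCMField.complexConj L) 3).Adelic), borelConstantTerm ν 𝓕 (E z) g = φ g * (((borelHeight g : ℝ≥0) : ℝ) : ℂ) ^ z + ψ z g * (((borelHeight g : ℝ≥0) : ℝ) : ℂ) ^ (2 - z)) ∧
      (∀ᶠ z in 𝓝[≠] ((3 : ℂ) / 2), ∀ g, ψ z g = qc z * φt z g) ∧
      (∀ g, ContinuousAt (fun z => φt z g) ((3 : ℂ) / 2)) ∧ φt ((3 : ℂ) / 2) g₁ ≠ 0 ∧ (∀ g, ‖φt ((3 : ℂ) / 2) g‖ ≤ M / ‖A ((3 : ℂ) / 2)‖) := by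
  have hpow : ∀ (g : (quasiSplit (↥(maximalRealSubfield L)) L (IsCMField.complexConj L) 3).Adelic) (w : ℂ), (((borelHeight g : ℝ≥0) : ℝ) : ℂ) ^ w ≠ 0 := fun g w =>
    Complex.cpow_ne_zero_iff.2 (Or.inl (Complex.ofReal_ne_zero.2 (NNReal.coe_pos.2 (borelHeight_pos g)).ne'))
  -- the open domain and the holomorphy of the middle coefficient there (★ CT-holomorphy of a family with rows, ★ `hψa ⇐ hE3c`)
  have hUo : IsOpen ({z : ℂ | 1 < z.re} \ C) := (isOpen_lt continuous_const Complex.continuous_re).sdiff hCc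
  have h𝓕top : ν 𝓕 ≠ ∞ := ((measure_mono subset_closure).trans_lt h𝓕c.measure_lt_top).ne
  have hE3c : ∀ g, DifferentiableOn ℂ (fun z => borelConstantTerm ν 𝓕 (E z) g) ({z : ℂ | 1 < z.re} \ C) :=
    differentiableOn_borelConstantTerm_family ν h𝓕N.nullMeasurableSet h𝓕top h𝓕c E hUo hEd hE4 hEbd
  have hψa := differentiableOn_middleCoefficient_of_borelConstantTerm ν 𝓕 E hE3c φ
    (fun z g => (borelConstantTerm ν 𝓕 (E z) g - φ g * (((borelHeight g : ℝ≥0) : ℝ) : ℂ) ^ z) / (((borelHeight g : ℝ≥0) : ℝ) : ℂ) ^ (2 - z)) (fun z _ g => rfl)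
  -- ★ (a-8) on the co-countable domain, ★ (a-7) for the profile
  have hfac := eventually_factorisation_of_unfolded_off (fun z g => (borelConstantTerm ν 𝓕 (E z) g - φ g * (((borelHeight g : ℝ≥0) : ℝ) : ℂ) ^ z) / (((borelHeight g : ℝ≥0) : ℝ) : ℂ) ^ (2 - z)) q qc hqcq hPcd hqa A hA hA32 cS hq
    Ag hAg hψ2 hCc hCcount hC32 hψa
  obtain ⟨hφt, hg₀, hφtbd⟩ := normalisedSection_letters A hA hA32 Ag hAg g₁ hAg1 hM
  refine ⟨fun z g => (borelConstantTerm ν 𝓕 (E z) g - φ g * (((borelHeight g : ℝ≥0) : ℝ) : ℂ) ^ z) / (((borelHeight g : ℝ≥0) : ℝ) : ℂ) ^ (2 - z), fun z g => Ag g z / A z, fun z g => ?_, hfac, hφt, hg₀, hφtbd⟩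
  rw [div_mul_cancel₀ _ (hpow g (2 - z)), add_sub_cancel]

/-- **THE ℓ-CT LEDGER OF RECORD AT (V)'s DOMAIN `({1<Re} ∖ {3∕2}) ∩ Pᶜ`** (`P` the named closed co-discrete candidate pole set): `ctLedger_of_amplitudeRows` at `C := {3∕2} ∪ P` — closed,
countable (★ `countable_of_codiscrete`), avoided by a punctured neighbourhood of `3∕2` — with the rows `hEd hE4 hEbd` read on (V) OF RECORD's `D` (same set).
[cite: MoeglinWaldspurger1995, II.1.7, IV.1.9–IV.1.11] [cite: Langlands1976, §7, Appendix] [cite: Rogawski1990, §2.1] -/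
theorem ctLedger_of_amplitudeRows_codiscrete
    (ν : Measure ↥(adelicUnipotent (↥(maximalRealSubfield L)) L (IsCMField.complexConj L) 3)) [ν.IsHaarMeasure] {𝓕 : Set ↥(adelicUnipotent (↥(maximalRealSubfield L)) L (IsCMField.complexConj L) 3)}
    (h𝓕N : IsFundamentalDomain ↥(rationalUnipotent (↥(maximalRealSubfield L)) L (IsCMField.complexConj L) 3) 𝓕 ν) (h𝓕c : IsCompact (closure 𝓕))
    (E : ℂ → (quasiSplit (↥(maximalRealSubfield L)) L (IsCMField.complexConj L) 3).Adelic → ℂ) (φ : (quasiSplit (↥(maximalRealSubfield L)) L (IsCMField.complexConj L) 3).Adelic → ℂ)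
    {P : Set ℂ} (hPc : IsClosed P) (hPcd : ∀ z₀ : ℂ, ∀ᶠ s in 𝓝[≠] z₀, s ∉ P)
    (hEd : ∀ g, DifferentiableOn ℂ (fun z => E z g) (({z : ℂ | 1 < z.re} \ (↑({(3 : ℂ) / 2} : Finset ℂ) : Set ℂ)) ∩ Pᶜ))
    (hE4 : ∀ z ∈ (({z : ℂ | 1 < z.re} \ (↑({(3 : ℂ) / 2} : Finset ℂ) : Set ℂ)) ∩ Pᶜ), Continuous (E z))
    (hEbd : ∀ z₁ ∈ (({z : ℂ | 1 < z.re} \ (↑({(3 : ℂ) / 2} : Finset ℂ) : Set ℂ)) ∩ Pᶜ), ∀ K : Set (quasiSplit (↥(maximalRealSubfield L)) L (IsCMField.complexConj L) 3).Adelic, IsCompact K → ∃ V ∈ 𝓝 z₁, ∃ M : ℝ, ∀ z ∈ V, ∀ g ∈ K, ‖E z g‖ ≤ M)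
    (q qc : ℂ → ℂ) {P' : Set ℂ} (hqcq : ∀ z : ℂ, 2 < z.re → qc z = q z) (hPcd' : ∀ z₀ : ℂ, ∀ᶠ s in 𝓝[≠] z₀, s ∉ P') (hqa : ∀ z : ℂ, z ∉ P' → AnalyticAt ℂ qc z)
    (A : ℂ → ℂ) (hA : DifferentiableOn ℂ A {z : ℂ | 1 < z.re}) (hA32 : A (3 / 2) ≠ 0)
    (cS : ℂ → ℂ) (hq : ∀ z : ℂ, 2 < z.re → q z = A z * cS z)
    (Ag : (quasiSplit (↥(maximalRealSubfield L)) L (IsCMField.complexConj L) 3).Adelic → ℂ → ℂ) (hAg : ∀ g, DifferentiableOn ℂ (Ag g) {z : ℂ | 1 < z.re}) (g₁ : (quasiSplit (↥(maximalRealSubfield L)) L (IsCMField.complexConj L) 3).Adelic) (hAg1 : Ag g₁ = A)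
    {M : ℝ} (hM : ∀ g, ‖Ag g (3 / 2)‖ ≤ M)
    (hψ2 : ∀ z : ℂ, 2 < z.re → ∀ g : (quasiSplit (↥(maximalRealSubfield L)) L (IsCMField.complexConj L) 3).Adelic, (borelConstantTerm ν 𝓕 (E z) g - φ g * (((borelHeight g : ℝ≥0) : ℝ) : ℂ) ^ z) / (((borelHeight g : ℝ≥0) : ℝ) : ℂ) ^ (2 - z) = Ag g z * cS z) :
    ∃ (ψ φt : ℂ → (quasiSplit (↥(maximalRealSubfield L)) L (IsCMField.complexConj L) 3).Adelic → ℂ),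
      (∀ (z : ℂ) (g : (quasiSplit (↥(maximalRealSubfield L)) L (IsCMField.complexConj L) 3).Adelic), borelConstantTerm ν 𝓕 (E z) g = φ g * (((borelHeight g : ℝ≥0) : ℝ) : ℂ) ^ z + ψ z g * (((borelHeight g : ℝ≥0) : ℝ) : ℂ) ^ (2 - z)) ∧
      (∀ᶠ z in 𝓝[≠] ((3 : ℂ) / 2), ∀ g, ψ z g = qc z * φt z g) ∧
      (∀ g, ContinuousAt (fun z => φt z g) ((3 : ℂ) / 2)) ∧ φt ((3 : ℂ) / 2) g₁ ≠ 0 ∧ (∀ g, ‖φt ((3 : ℂ) / 2) g‖ ≤ M / ‖A ((3 : ℂ) / 2)‖) := by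
  -- `({1<Re} ∖ {3∕2}) ∩ Pᶜ = {1<Re} ∖ ({3∕2} ∪ P)`
  have hset : ({z : ℂ | 1 < z.re} \ (↑({(3 : ℂ) / 2} : Finset ℂ) : Set ℂ)) ∩ Pᶜ = {z : ℂ | 1 < z.re} \ ((↑({(3 : ℂ) / 2} : Finset ℂ) : Set ℂ) ∪ P) := by
    rw [← Set.sdiff_eq, Set.sdiff_sdiff]
  have hCc : IsClosed ((↑({(3 : ℂ) / 2} : Finset ℂ) : Set ℂ) ∪ P) := (Finset.finite_toSet _).isClosed.union hPc
  have hCcount : ((↑({(3 : ℂ) / 2} : Finset ℂ) : Set ℂ) ∪ P).Countable := (Finset.countable_toSet _).union (countable_of_codiscrete hPcd)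
  have hC32 : ∀ᶠ z in 𝓝[≠] ((3 : ℂ) / 2), z ∉ (↑({(3 : ℂ) / 2} : Finset ℂ) : Set ℂ) ∪ P := by
    filter_upwards [self_mem_nhdsWithin, hPcd ((3 : ℂ) / 2)] with z hz hzP
    rintro (h | h)
    · rw [Finset.coe_singleton, mem_singleton_iff] at h
      exact hz h
    · exact hzP h
  rw [hset] at hEd hE4 hEbd
  exact ctLedger_of_amplitudeRows L ν h𝓕N h𝓕c E φ hCc hCcount hC32 hEd hE4 hEbd q qc hqcq hPcd' hqa A hA hA32 cS hq Ag hAg g₁ hAg1 hM hψ2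

end CM

end Summit.HodgeConjecture.HodgeConjecture.Cruxes.H413.K2E1ChiConstantTermLedgerOfRecordCMThree

end
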